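import Summits.AtomisticToContinuum.Crystallization.Theorems.PalmUnimodularRigidityLayeredLawsSelectHcpDefs
import Summits.AtomisticToContinuum.Crystallization.Theorems.PalmUnimodularRigidityCruxesToPalmRigidity

/-!
# Crux `LayeredLawsSelectHcp` (stmt-AtomisticToContinuum-9226), line `mtp-prestress-split-ergodic-frame`:
# point-stationary laws are invariant under covariant bijective point-shifts

Registered sub-goal `tube_pointShift_invariance` of the crux item (the work-horse of every law-level step of
the line: "stationarity along the chart" for the rigidity stub — MTP additivity of mean labelled bond vectors,
averaging over chart moves — and layer-chain stationarity for the selection stub).  For a law `P` on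
configurations `μ : Measure ℝ³` satisfying the crux's Mecke identity (`PointStationary`, the `−y` convention),
carried by PURELY ATOMIC, LOCALLY FINITE configurations, and a jointly measurable POINT MAP `τ μ y` which, almost
surely, (i) sends the root to an atom of unit mass (`μ {τ μ 0} = 1`), (ii) is COVARIANT under re-rooting at
atoms (`τ (θ_y μ) 0 = τ μ y − y`) and (iii) is BIJECTIVE onto the root in the counting sense
(`μ {y | τ μ y = 0} = 1`), the law of the configuration RE-ROOTED AT `τ μ 0` is again `P`:
`∫⁻ f (θ_{τ μ 0} μ) dP = ∫⁻ f dP` for every measurable `f ≥ 0`.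
This is the easy direction of Heveling–Last's characterisation of Palm / point-stationary laws by bijective
point-shifts [HevelingLast2005, Thm. 4.1; Thorisson 2000]: Mecke with
`g(μ, y) = f(θ_y μ)·1[y = τ μ 0]`; the mass sent is `f(θ_τ μ)`, the mass received is `f(μ)·#{y : τ μ y = 0} = f(μ)`.
Measurability of `g` on the whole Giry space uses the landed s-finite modification of the identity kernel on
locally finite configurations (`PalmUnimodularRigidity.exists_isSFiniteKernel_apply_eq_self`,
`measurable_map_sub_kernel`).  [cite: HevelingLast2005, Theorem 4.1]
-/

noncomputable section

open MeasureTheory ProbabilityTheory Set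
open scoped ENNReal

namespace Summit.AtomisticToContinuum.Crystallization.Theorems.PalmUnimodularRigidity.LayeredLawsSelectHcp

open Summit.AtomisticToContinuum.Crystallization.Theorems.LayeredLawsSelectHcp.Negative.DiracLaws (PointStationary)
open Summit.AtomisticToContinuum.Crystallization.Theorems.PalmUnimodularRigidity
  (exists_isSFiniteKernel_apply_eq_self measurable_map_sub_kernel measurableSet_floorNorm_preimage)

/-- Euclidean `3`-space. [folklore] -/
local notation "E3" => EuclideanSpace ℝ (Fin 3)

/-- Integral against `μ` of a function supported on one point `t`: `∫⁻ y, 1[y = t]·c ∂μ = c · μ {t}`.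
[folklore] -/
theorem lintegral_indicator_singleton_const (μ : Measure E3) (t : E3) (c : ℝ≥0∞) :
    ∫⁻ y, ({t} : Set E3).indicator (fun _ => c) y ∂μ = c * μ {t} := by
  rw [lintegral_indicator (measurableSet_singleton t), setLIntegral_const]

/-- Re-rooting twice returns the configuration: `θ_{−y} (θ_y μ) = μ`. [folklore] -/
theorem map_sub_neg_map_sub (μ : Measure E3) (y : E3) :
    Measure.map (fun z => z - -y) (Measure.map (fun z => z - y) μ) = μ := by
  rw [Measure.map_map (measurable_sub_const (-y)) (measurable_sub_const y)]
  have : ((fun z : E3 => z - -y) ∘ fun z => z - y) = id := by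
    funext z; simp
  rw [this, Measure.map_id]

/-- **Re-rooting preserves local finiteness**: if every norm shell `{⌊‖z‖⌋₊ = n}` has finite `μ`-mass, the
same holds for `θ_y μ = μ.map (· − y)` (a translated shell is bounded, hence inside finitely many shells).
[folklore] -/
theorem locallyFinite_map_sub {μ : Measure E3} (hμ : ∀ n : ℕ, μ ((fun z : E3 => ⌊‖z‖⌋₊) ⁻¹' {n}) < ⊤)
    (y : E3) (n : ℕ) : (Measure.map (fun z => z - y) μ) ((fun z : E3 => ⌊‖z‖⌋₊) ⁻¹' {n}) < ⊤ := by
  rw [Measure.map_apply (measurable_sub_const y) (measurableSet_floorNorm_preimage n)]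
  set N : ℕ := n + 1 + ⌈‖y‖⌉₊ with hN
  have hsub : (fun z : E3 => z - y) ⁻¹' ((fun z : E3 => ⌊‖z‖⌋₊) ⁻¹' {n}) ⊆
      ⋃ m ∈ Finset.range (N + 1), (fun z : E3 => ⌊‖z‖⌋₊) ⁻¹' {m} := by
    intro z hz
    have hz' : ⌊‖z - y‖⌋₊ = n := hz
    have h1 : ‖z - y‖ < n + 1 := by
      have := Nat.lt_floor_add_one ‖z - y‖
      rw [hz'] at this
      exact_mod_cast this
    have h2 : ‖z‖ ≤ ‖z - y‖ + ‖y‖ := by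
      have := norm_add_le (z - y) y
      rwa [sub_add_cancel] at this
    have h3 : (‖y‖ : ℝ) ≤ ⌈‖y‖⌉₊ := Nat.le_ceil _
    have h4 : ‖z‖ < (N : ℝ) + 1 := by
      rw [hN]; push_cast; linarith
    have h5 : ⌊‖z‖⌋₊ ≤ N := by
      have := Nat.floor_le (norm_nonneg z)
      have h6 : (⌊‖z‖⌋₊ : ℝ) < N + 1 := lt_of_le_of_lt this h4
      exact_mod_cast Nat.lt_succ_iff.1 (by exact_mod_cast h6)
    refine Set.mem_iUnion₂.2 ⟨⌊‖z‖⌋₊, Finset.mem_range.2 (Nat.lt_succ_of_le h5), rfl⟩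
  refine (measure_mono hsub).trans_lt ?_
  refine (measure_biUnion_finset_le _ _).trans_lt ?_
  exact ENNReal.sum_lt_top.2 fun m _ => hμ m

/-- **Registered sub-goal `tube_pointShift_invariance`: point-stationary laws are invariant under covariant
bijective point-shifts** (Heveling–Last, easy direction).  Hypotheses: the crux's Mecke identity; a.s. the
configuration is purely atomic (`μ {y | μ {y} = 0} = 0`) and locally finite (finite mass on the norm shells
`{⌊‖z‖⌋₊ = n}`) — counting measures of hard-core sets have both; a jointly measurable point map `τ` with,
almost surely, (i) `μ {τ μ 0} = 1`, (ii) covariance at atoms `τ (θ_y μ) 0 = τ μ y − y`,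
(iii) `μ {y | τ μ y = 0} = 1`.  Conclusion: `E f(θ_{τ μ 0} μ) = E f(μ)` for all measurable `f ≥ 0`.
[cite: HevelingLast2005, Theorem 4.1] -/
theorem tube_pointShift_invariance :
    ∀ P : Measure (Measure E3), PointStationary P →
      (∀ᵐ μ ∂P, μ {y : E3 | μ {y} = 0} = 0) →
      (∀ᵐ μ ∂P, ∀ n : ℕ, μ ((fun z : E3 => ⌊‖z‖⌋₊) ⁻¹' {n}) < ⊤) →
      ∀ τ : Measure E3 → E3 → E3, Measurable (Function.uncurry τ) →
        (∀ᵐ μ ∂P, μ {τ μ 0} = 1) →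
        (∀ᵐ μ ∂P, ∀ y : E3, μ {y} ≠ 0 → τ (Measure.map (fun z => z - y) μ) 0 = τ μ y - y) →
        (∀ᵐ μ ∂P, μ {y : E3 | τ μ y = 0} = 1) →
        ∀ f : Measure E3 → ℝ≥0∞, Measurable f →
          ∫⁻ μ, f (Measure.map (fun z => z - τ μ 0) μ) ∂P = ∫⁻ μ, f μ ∂P := by
  intro P hstat hatom hlf τ hτ hroot hcov hbij f hf
  -- an s-finite kernel agreeing with the identity on locally finite configurations
  obtain ⟨κ, hκ, hκid⟩ := exists_isSFiniteKernel_apply_eq_self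
    (fun n : ℕ => (fun z : E3 => ⌊‖z‖⌋₊) ⁻¹' {n}) measurableSet_floorNorm_preimage
    (fun i j hij => Set.disjoint_iff.2 fun z hz => hij (hz.1.symm.trans hz.2))
    (fun z => ⟨⌊‖z‖⌋₊, rfl⟩)
  -- the transport function `g(μ, y) = f(θ_y μ) · 1[y = τ μ 0]` (with `κ μ` for `μ` inside `θ_y`)
  have hτ0 : Measurable fun μ : Measure E3 => τ μ 0 := hτ.comp (measurable_id.prodMk measurable_const)
  have hdiag : MeasurableSet {p : Measure E3 × E3 | p.2 = τ p.1 0} :=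
    measurableSet_eq_fun measurable_snd (hτ0.comp measurable_fst)
  set g : Measure E3 → E3 → ℝ≥0∞ := fun μ y =>
    {p : Measure E3 × E3 | p.2 = τ p.1 0}.indicator (fun p => f ((κ p.1).map (fun z => z - p.2))) (μ, y)
    with hg_def
  have hg : Measurable (Function.uncurry g) := by
    have : Function.uncurry g =
        {p : Measure E3 × E3 | p.2 = τ p.1 0}.indicator (fun p => f ((κ p.1).map (fun z => z - p.2))) := by
      funext p; rfl
    rw [this]
    exact (hf.comp (measurable_map_sub_kernel κ)).indicator hdiag
  have hMecke := hstat g hg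
  have hgval : ∀ ν y, g ν y =
      {p : Measure E3 × E3 | p.2 = τ p.1 0}.indicator (fun p => f ((κ p.1).map (fun z => z - p.2))) (ν, y) :=
    fun _ _ => rfl
  -- LEFT side: the mass sent from the root is `f(θ_{τ μ 0} μ)`
  have hL : ∫⁻ μ, ∫⁻ y, g μ y ∂μ ∂P = ∫⁻ μ, f (Measure.map (fun z => z - τ μ 0) μ) ∂P := by
    refine lintegral_congr_ae ?_
    filter_upwards [hlf, hroot] with μ hμ hμ1
    have hgy : ∀ y, g μ y = ({τ μ 0} : Set E3).indicator
        (fun _ => f (Measure.map (fun z => z - τ μ 0) μ)) y := by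
      intro y
      by_cases hy : y = τ μ 0
      · subst hy
        rw [Set.indicator_of_mem (Set.mem_singleton _), hgval,
          Set.indicator_of_mem (show (μ, τ μ 0) ∈ {p : Measure E3 × E3 | p.2 = τ p.1 0} from rfl)]
        simp only [hκid μ hμ]
      · rw [Set.indicator_of_notMem (fun h => hy (Set.mem_singleton_iff.1 h)), hgval,
          Set.indicator_of_notMem (show (μ, y) ∉ {p : Measure E3 × E3 | p.2 = τ p.1 0} from hy)]
    show ∫⁻ y, g μ y ∂μ = f (Measure.map (fun z => z - τ μ 0) μ)
    simp_rw [hgy]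
    rw [lintegral_indicator_singleton_const, hμ1, mul_one]
  -- RIGHT side: the mass received at the root is `f(μ) · μ{y : τ μ y = 0} = f(μ)`
  have hR : ∫⁻ μ, ∫⁻ y, g (Measure.map (fun z => z - y) μ) (-y) ∂μ ∂P = ∫⁻ μ, f μ ∂P := by
    refine lintegral_congr_ae ?_
    filter_upwards [hatom, hlf, hcov, hbij] with μ hμat hμ hμcov hμbij
    have hτμ : Measurable (τ μ) := hτ.comp (measurable_const.prodMk measurable_id)
    have hset : MeasurableSet {y : E3 | τ μ y = 0} := hτμ (measurableSet_singleton 0)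
    -- the integrands agree at every ATOM `y`, hence `μ`-a.e.
    have hgy : ∀ y, μ {y} ≠ 0 →
        g (Measure.map (fun z => z - y) μ) (-y) = {y : E3 | τ μ y = 0}.indicator (fun _ => f μ) y := by
      intro y hy
      have hcovy := hμcov y hy
      have hlfy := locallyFinite_map_sub hμ y
      by_cases h0 : τ μ y = 0
      · have hmem : (Measure.map (fun z => z - y) μ, -y) ∈ {p : Measure E3 × E3 | p.2 = τ p.1 0} := by
          show -y = τ (Measure.map (fun z => z - y) μ) 0
          rw [hcovy, h0, zero_sub]
        rw [Set.indicator_of_mem (show y ∈ {y : E3 | τ μ y = 0} from h0), hgval, Set.indicator_of_mem hmem]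
        simp only [hκid _ hlfy, map_sub_neg_map_sub]
      · have hnmem : (Measure.map (fun z => z - y) μ, -y) ∉ {p : Measure E3 × E3 | p.2 = τ p.1 0} := by
          intro h
          apply h0
          have h' : -y = τ (Measure.map (fun z => z - y) μ) 0 := h
          rw [hcovy] at h'
          have h'' := congrArg (fun w => w + y) h'
          simp only [neg_add_cancel, sub_add_cancel] at h''
          exact h''.symm
        rw [Set.indicator_of_notMem (show y ∉ {y : E3 | τ μ y = 0} from h0), hgval,
          Set.indicator_of_notMem hnmem]
    have hae : ∀ᵐ y ∂μ, g (Measure.map (fun z => z - y) μ) (-y) =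
        {y : E3 | τ μ y = 0}.indicator (fun _ => f μ) y := by
      have h := (measure_eq_zero_iff_ae_notMem.1 hμat)
      filter_upwards [h] with y hy
      exact hgy y hy
    show ∫⁻ y, g (Measure.map (fun z => z - y) μ) (-y) ∂μ = f μ
    rw [lintegral_congr_ae hae, lintegral_indicator hset, setLIntegral_const, hμbij, mul_one]
  rw [← hL, hMecke, hR]

end Summit.AtomisticToContinuum.Crystallization.Theorems.PalmUnimodularRigidity.LayeredLawsSelectHcp

end
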